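import Summits.QuantumFields.BalabanUV.Beta.EriceRemainderEnclosureHistoryAutonomyComparisonPrinciple

/-!
# EriceRemainderEnclosureHistoryAutonomyComparisonBarrier — (E61a) BARRIERS FOR THE STEP: under the induction down the levels the perturbed trajectory
# from a pin is squeezed between the base trajectory and EVERY super-solution of «the `B′`-flow driven along the BASE family»
# (`1∕k_{m+1}² ≥ 1∕k_m² + B′(S k_{m+1})`, `k_0 = y`); the STEP — hence comparison at any size — follows from ONE barrier with `B (S y) ≤ B′ k`
# (`effective_le_all_of_barrier`); for the floor shift `B′ = B + ε` the base trajectory DELAYED BY `m·ε` at scale `m` is always a barrier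
# (`le_of_floor_shift_of_delay`), the common mechanism behind the thresholds `M·y ≤ 3√3·b` of (E49j) and `Q ≤ 2` of (E58b)

Cell `pub-balaban`, β-function sub-cell, BINDER row D4 «RemainderConst leaves for Bałaban's split» (`HOME/BINDER-OWNERS.md`; owner lineage `b2b-balaban-beta-an4`;
this file by co-owner #2 lineage `b2b-balaban-beta-d4-p2`, generation 54), β-FLOW TEAM duty (1), FREEZE (0) honoured (def-free; (E49k)'s `family_le_of_orbit` ∕
`level_orbit_ge`, (E49j)'s `effective_le_of_small_pin`, (E48a)'s `family_zero` ∕ `family_mem` ∕ `family_tail_eq` ∕ `strictMonoOn_scale`, (E39)'s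
`exists_memFlow_zm`, (E43b)'s `memFlow_unique_of_monotone_zm`, (E38a)'s `three_sqrt_three_pos` ∕ `weight_sharp_le` ∕ `le_inv_sqrt_of_le_inv_sq`, node U2's
`invSq_eq_of_memFlow` ∕ `mul_lower_le_drive` ∕ `Sharpness.abs_sub_le_half_cube_mul` BY NAME; nothing restated).  Sequel of (E58a) `…ComparisonPrinciple`
(the induction down the levels with THE STEP abstracted) and of the numerics of `HOME/b2b-balaban-beta-d4-p2/g53/e60/README.md` (route (A′): «constant excess
first»); records and numerics in `HOME/b2b-balaban-beta-d4-p2/g54/e61/README.md`.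

HONEST FRAMING (page 1, verbatim and binding).  *"Discharging BetaPertH makes Bałaban's UV stability UNCONDITIONAL — a real constructive-QFT result; it is
NOT the continuum limit and NOT the Clay problem."*  THIS FILE DISCHARGES NOTHING OF THE KIND.  Elementary real analysis about ABSTRACT functionals on a box
]0,γ]^ℕ with displayed floors, moduli and signs — hypotheses of a census, not facts; the form, signs and moments of Bałaban's (1.22) limit functional are NOT
PRINTED ([I] p. 298; GAPS G-t4-U2-1∕-2) and NOT asserted.  Row D4 class UNCHANGED (critical-path width 0; instance 0∕1; D4 DISCHARGE NO DATE).  HONEST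
DEPENDENCY: continuum YM on T⁴ ⇐ BetaPertH ∧ nine spine estimates (0/9 proved); BetaPertH ⇐ (D1) ∧ (D4) ∧ CAP+tail; G-an2-4 gates asym, D1 and NE2/3/4.

THE POINT (census sense (α); the COMPARISON column of the autonomy row).  Along a box solution the flow with memory IS a one-step implicit recursion in
the effective β-function `Φ_B = B ∘ S` of (E48b): `1∕h_{m+1}² = 1∕h_m² + Φ_B(h_{m+1})` (autonomy, `h(m+1+·) = S(h_{m+1})`).  (E49k)∕(E58a) prove the order
`Φ_B ≤ Φ_{B′}` by induction down the levels, and the induction hypothesis is worth more than the comparison `h′ ≤ h` it was used for: at every pin `z` at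
least one floor step deeper it gives the order AND comparison from `z` (§1 `effective_le_all_of_step_below`).  Consequently every increment of the
perturbed trajectory `h′ = S′ y` is read on the BASE family: `1∕h′_{m+1}² − 1∕h′_m² = B′(S′ h′_{m+1}) ≤ B′(S h′_{m+1})` (`S′ z ≤ S z` at the deeper pin
`z = h′_{m+1}`, `B′` isotone) — `h′` is a SUB-solution of «the `B′`-flow driven along the base family», whose one-step map is increasing; so `h′` lies
ABOVE every SUPER-solution `k` of that flow from the same pin (a BARRIER: `k_0 = y`, `1∕k_m² + B′(S k_{m+1}) ≤ 1∕k_{m+1}²`; §2 `barrier_le`, an induction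
with no estimate), and THE STEP `B h ≤ B′ h′` follows from `B (S y) ≤ B′ k` for ONE barrier (§3 `effective_le_all_of_barrier`).  This turns the step —
a statement about a PAIR of implicit flows — into the search for one explicit sequence tested against the base family alone; the optimal barrier is
the exact accelerated flow `1∕k_{m+1}² = 1∕k_m² + B′(S k_{m+1})`, i.e. the TIME-SHIFT picture of `g51/e58/README.md` made a theorem (the perturbed
trajectory runs ahead of the base one, and its memory terms are read at the LATER points of the base family — retardation included).  For the floor
shift `B′ = B + ε` (§4) the base trajectory delayed by the accumulated excess, `1∕k_m² = 1∕h_m² + m·ε`, is ALWAYS a barrier (`delay_barrier`: `k ≤ h`,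
pin monotonicity of `Φ_B`), and its payoff `B h ≤ B k + ε` is exactly the estimate behind BOTH classical thresholds — `|B h − B k| ≤ M·sup_m (h_m −
k_m) ≤ M·y∕(3√3·b)·ε` (§4 `delay_payoff_of_zm`, (E49j)(2)'s `3√3`) and `Σ_k L_k (h_k − k_k) ≤ (Q∕2)·ε` ((E58b)'s level weight) — so `le_of_floor_shift_of_delay`
is their common family-free END for floor shifts.  NUMERICS (README): the exact accelerated flow improves the level-weight bound `Q∕2` only by the
retardation factor (`T ≈ 0.86·Q∕2`, true linear response `≈ 0.65·T`); barrier methods provably stop at `T ≤ 1` while hyper-separated towers of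
`≥ 3` unit blocks would have `T > 1` — the general conjecture (E58′) needs the self-consistent damping `ξ = ε − 𝒟[ξ]` along the orbit (zone product
heuristic `Ψ_i = Ψ_{i+1}∕(1 + C_i)`), recorded there.  NOT CLAIMED: any new trajectory-free class; necessity of the barrier condition; anything printed.

WHAT IS PROVED ([folklore]; 0 `def`, 0 sorry).  §1 **`effective_le_all_of_step_below`** (the induction of (E58a) with order + comparison at every
deeper pin handed to the step).  §2 `le_of_invSq_le`, **`barrier_le`**.  §3 **`effective_le_all_of_barrier`**.  §4 `delay_barrier`,
**`effective_le_all_of_delay`**, `delay_payoff_of_zm`, **`le_of_floor_shift_of_delay`**.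
-/
noncomputable section
open Finset Set

namespace Summit.QuantumFields.BalabanUV.Beta.EriceRemainderEnclosureHistoryAutonomyComparisonBarrier

open Literature.MathematicalPhysics.QuantumFieldTheory.Balaban1983to89
open Literature.MathematicalPhysics.QuantumFieldTheory.Balaban1983to89.T4BetaStationary
open Literature.MathematicalPhysics.QuantumFieldTheory.Balaban1983to89.T4BetaFlowWellPosed
open Literature.MathematicalPhysics.QuantumFieldTheory.Balaban1983to89.T4BetaFlowWellPosed.Sharpness (abs_sub_le_half_cube_mul)
open Summit.QuantumFields.BalabanUV.Beta.EriceRemainderEnclosureHistoryAutonomyThreshold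
  (three_sqrt_three_pos weight_sharp_le le_inv_sqrt_of_le_inv_sq)
open Summit.QuantumFields.BalabanUV.Beta.EriceRemainderEnclosureHistoryAutonomyOrder
open Summit.QuantumFields.BalabanUV.Beta.EriceRemainderEnclosureHistoryAutonomyComparisonExcess (effective_le_of_small_pin)
open Summit.QuantumFields.BalabanUV.Beta.EriceRemainderEnclosureHistoryAutonomyComparisonIsotoneExcess (family_le_of_orbit level_orbit_ge)
open Summit.QuantumFields.BalabanUV.Beta.EriceRemainderEnclosureHistoryAutonomyExistence (exists_memFlow_zm)
open Summit.QuantumFields.BalabanUV.Beta.EriceRemainderEnclosureHistoryAutonomyMonotoneGeneral (memFlow_unique_of_monotone_zm)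

variable {B B' : (ℕ → ℝ) → ℝ} {M M' γ b y ε : ℝ} {h h' : ℕ → ℝ} {S S' : ℝ → ℕ → ℝ}

/-! ## §1 The induction down the levels hands the step MORE: order and comparison at every deeper pin -/

/-- **THE COMPARISON PRINCIPLE WITH THE DEEPER PINS HANDED TO THE STEP.**  Data as in (E58a) `effective_le_all_of_step` (`B` with zeroth moment `M ≥ 0`
and floor `b > 0` on ]0,γ]; `B ≤ B′` with ISOTONE excess; `B′` with zeroth moment `M′ ≥ 0` and floor `b′ > 0`; unique solution families `S`, `S′`).
Suppose THE STEP in the weaker form: for every pin `y ∈ ]0,γ]` SUCH THAT the effective β-functions are ordered (`B (S z) ≤ B′ (S′ z)`) and the families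
compare (`S′ z ≤ S z` at every scale) at EVERY pin `z ∈ ]0,γ]` at least one floor step deeper (`1∕y² + b ≤ 1∕z²`), box solutions `h`, `h′` of `B`, `B′`
from `y` with `h′ ≤ h` satisfy `B h ≤ B′ h′`.  Then `B (S y) ≤ B′ (S′ y)` at EVERY pin — (E49k)'s induction on the number of floor steps below the level
`4M²∕(27b²)` carries exactly this hypothesis (order at deeper pins is the induction hypothesis; comparison from them is `family_le_of_orbit`). [folklore] -/
theorem effective_le_all_of_step_below {b' : ℝ}
    (hB : ∀ u u' : ℕ → ℝ, SeqBox γ u → SeqBox γ u' → ∀ D : ℝ, (∀ j, |u j - u' j| ≤ D) → |B u - B u'| ≤ M * D)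
    (hM : 0 ≤ M) (hγ : 0 < γ) (hb : 0 < b) (hlo : ∀ u, SeqBox γ u → b ≤ B u) (hexc : ∀ u, SeqBox γ u → B u ≤ B' u)
    (hDmono : ∀ u v : ℕ → ℝ, SeqBox γ u → SeqBox γ v → (∀ j, u j ≤ v j) → B' u - B u ≤ B' v - B v)
    (hb' : 0 < b') (hB' : ∀ u u' : ℕ → ℝ, SeqBox γ u → SeqBox γ u' → ∀ D : ℝ, (∀ j, |u j - u' j| ≤ D) → |B' u - B' u'| ≤ M' * D)
    (hM' : 0 ≤ M') (hlo' : ∀ u, SeqBox γ u → b' ≤ B' u)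
    (hS : ∀ p, 0 < p → p ≤ γ → SeqBox γ (S p) ∧ MemFlow B p (S p))
    (huniq : ∀ p, 0 < p → p ≤ γ → ∀ u u' : ℕ → ℝ, SeqBox γ u → SeqBox γ u' → MemFlow B p u → MemFlow B p u' → u = u')
    (hS' : ∀ p, 0 < p → p ≤ γ → SeqBox γ (S' p) ∧ MemFlow B' p (S' p))
    (huniq' : ∀ p, 0 < p → p ≤ γ → ∀ u u' : ℕ → ℝ, SeqBox γ u → SeqBox γ u' → MemFlow B' p u → MemFlow B' p u' → u = u')
    (hstep : ∀ y, 0 < y → y ≤ γ →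
      (∀ z, 0 < z → z ≤ γ → 1 / y ^ 2 + b ≤ 1 / z ^ 2 → B (S z) ≤ B' (S' z) ∧ ∀ j, S' z j ≤ S z j) →
      ∀ h h' : ℕ → ℝ, SeqBox γ h → MemFlow B y h → SeqBox γ h' → MemFlow B' y h' → (∀ j, h' j ≤ h j) → B h ≤ B' h') :
    ∀ y, 0 < y → y ≤ γ → B (S y) ≤ B' (S' y) := by
  have h33 : 0 < 3 * Real.sqrt 3 := three_sqrt_three_pos
  have hsq3 : Real.sqrt 3 ^ 2 = 3 := Real.sq_sqrt (by norm_num)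
  -- the level threshold Λ = 4M²/(27 b²): 1/y² ≥ Λ ⟹ M·y ≤ (3√3/2)·b
  set Λ : ℝ := 4 * M ^ 2 / (27 * b ^ 2) with hΛ_def
  have hbase : ∀ y, 0 < y → y ≤ γ → Λ ≤ 1 / y ^ 2 → B (S y) ≤ B' (S' y) := by
    intro y hy hyγ hlev
    have hMy : M * y ≤ 3 * Real.sqrt 3 / 2 * b := by
      have hy2 : 0 < y ^ 2 := by positivity
      have k1 : 4 * M ^ 2 ≤ 1 / y ^ 2 * (27 * b ^ 2) := (div_le_iff₀ (by positivity : (0:ℝ) < 27 * b ^ 2)).mp hlev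
      have k2 := mul_le_mul_of_nonneg_right k1 hy2.le
      have e : 1 / y ^ 2 * (27 * b ^ 2) * y ^ 2 = 27 * b ^ 2 := by field_simp
      rw [e] at k2
      have h1 : (2 * M * y) ^ 2 ≤ (3 * Real.sqrt 3 * b) ^ 2 := by nlinarith [hsq3, k2]
      have h2 : 2 * M * y ≤ 3 * Real.sqrt 3 * b := (sq_le_sq₀ (by positivity) (by positivity)).mp h1
      linarith
    exact effective_le_of_small_pin hB hM hb hlo hexc hDmono hy hyγ hMy (hS y hy hyγ).1 (hS y hy hyγ).2 (hS' y hy hyγ).1 (hS' y hy hyγ).2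
  -- induction on the number of floor steps below the threshold level
  have hind : ∀ n : ℕ, ∀ y, 0 < y → y ≤ γ → Λ - (n : ℝ) * b ≤ 1 / y ^ 2 → B (S y) ≤ B' (S' y) := by
    intro n
    induction n with
    | zero => intro y hy hyγ hlev; exact hbase y hy hyγ (by simpa using hlev)
    | succ n ih =>
      intro y hy hyγ hlev
      have hy' : y ∈ Ioc (0 : ℝ) γ := ⟨hy, hyγ⟩
      have hlev' : Λ - (n : ℝ) * b ≤ 1 / y ^ 2 + b := by rw [Nat.cast_succ] at hlev; linarith
      -- order AND comparison at every pin at least one floor step deeper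
      have hdeep : ∀ z, 0 < z → z ≤ γ → 1 / y ^ 2 + b ≤ 1 / z ^ 2 → B (S z) ≤ B' (S' z) ∧ ∀ j, S' z j ≤ S z j := by
        intro z hz hzγ hzlev
        refine ⟨ih z hz hzγ (hlev'.trans hzlev), family_le_of_orbit hb' hγ hB' hM' hlo' hS huniq hS' huniq' ⟨hz, hzγ⟩ fun j hj => ?_⟩
        have hm := family_mem hS hz hzγ j
        refine ih (S z j) hm.1 hm.2 ?_
        have := level_orbit_ge hb hlo hS (y := z) ⟨hz, hzγ⟩ hj
        linarith
      have hQ : ∀ j, 1 ≤ j → B (S (S y j)) ≤ B' (S' (S y j)) := fun j hj =>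
        (hdeep (S y j) (family_mem hS hy hyγ j).1 (family_mem hS hy hyγ j).2 (level_orbit_ge hb hlo hS hy' hj)).1
      have hcomp := family_le_of_orbit hb' hγ hB' hM' hlo' hS huniq hS' huniq' hy' hQ
      exact hstep y hy hyγ hdeep _ _ (hS y hy hyγ).1 (hS y hy hyγ).2 (hS' y hy hyγ).1 (hS' y hy hyγ).2 hcomp
  intro y hy hyγ
  obtain ⟨n, hn⟩ : ∃ n : ℕ, Λ / b ≤ n := exists_nat_ge (Λ / b)
  refine hind n y hy hyγ ?_
  have : Λ ≤ (n : ℝ) * b := by rw [div_le_iff₀ hb] at hn; linarith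
  have : 0 ≤ 1 / y ^ 2 := by positivity
  linarith

/-! ## §2 The barrier lemma: the perturbed trajectory lies above every super-solution of the `B′`-flow driven along the base family -/

/-- Positive reals are ordered against their inverse squares: `1∕a² ≤ 1∕c²` with `a > 0` gives `c ≤ a`. [folklore] -/
theorem le_of_invSq_le {a c : ℝ} (ha : 0 < a) (hle : 1 / a ^ 2 ≤ 1 / c ^ 2) : c ≤ a := by
  by_contra hlt
  rw [not_le] at hlt
  exact absurd hle (not_le.mpr (one_div_lt_one_div_of_lt (pow_pos ha 2) (pow_lt_pow_left₀ hlt ha.le two_ne_zero)))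

/-- **THE BARRIER LEMMA.**  `B` with zeroth moment `M ≥ 0` and floor `b > 0` on ]0,γ] with a unique solution family `S`; `B′` ISOTONE with floor `b` and a
unique solution family `S′`; a pin `y ∈ ]0,γ]` from which the families COMPARE AT EVERY DEEPER PIN (`S′ z ≤ S z` whenever `1∕y² + b ≤ 1∕z²`).  Let `k` be a
BARRIER from `y`: a box sequence with `k_0 = y` and `1∕k_m² + B′(S k_{m+1}) ≤ 1∕k_{m+1}²` for every `m` (a super-solution of the `B′`-flow whose memory term
is read along the BASE family).  Then `k ≤ S′ y` at EVERY scale.  (Induction on the scale, no estimate: if `S′ y (m+1) < k_{m+1}` then, reading the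
increment of `S′ y` on the base family at the deeper pin `S′ y (m+1)` and using the monotonicity of the scale maps of `S`, `1∕(S′ y (m+1))² ≤ 1∕k_m² +
B′(S k_{m+1}) ≤ 1∕k_{m+1}²`, i.e. `k_{m+1} ≤ S′ y (m+1)`.) [folklore] -/
theorem barrier_le
    (hmono' : ∀ u v : ℕ → ℝ, SeqBox γ u → SeqBox γ v → (∀ j, u j ≤ v j) → B' u ≤ B' v) (hγ : 0 < γ) (hb : 0 < b)
    (hB : ∀ u u' : ℕ → ℝ, SeqBox γ u → SeqBox γ u' → ∀ D : ℝ, (∀ j, |u j - u' j| ≤ D) → |B u - B u'| ≤ M * D)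
    (hM : 0 ≤ M) (hlo : ∀ u, SeqBox γ u → b ≤ B u) (hlo' : ∀ u, SeqBox γ u → b ≤ B' u)
    (hS : ∀ p, 0 < p → p ≤ γ → SeqBox γ (S p) ∧ MemFlow B p (S p))
    (huniq : ∀ p, 0 < p → p ≤ γ → ∀ u u' : ℕ → ℝ, SeqBox γ u → SeqBox γ u' → MemFlow B p u → MemFlow B p u' → u = u')
    (hS' : ∀ p, 0 < p → p ≤ γ → SeqBox γ (S' p) ∧ MemFlow B' p (S' p))
    (huniq' : ∀ p, 0 < p → p ≤ γ → ∀ u u' : ℕ → ℝ, SeqBox γ u → SeqBox γ u' → MemFlow B' p u → MemFlow B' p u' → u = u')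
    (hy : 0 < y) (hyγ : y ≤ γ) (hcomp : ∀ z, 0 < z → z ≤ γ → 1 / y ^ 2 + b ≤ 1 / z ^ 2 → ∀ j, S' z j ≤ S z j)
    {k : ℕ → ℝ} (hk : SeqBox γ k) (hk0 : k 0 = y) (hbar : ∀ m, 1 / k m ^ 2 + B' (S (k (m + 1))) ≤ 1 / k (m + 1) ^ 2) :
    ∀ m, k m ≤ S' y m
  | 0 => by rw [hk0, family_zero hS' hy hyγ]
  | m + 1 => by
    have ih := barrier_le hmono' hγ hb hB hM hlo hlo' hS huniq hS' huniq' hy hyγ hcomp hk hk0 hbar m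
    by_contra hlt
    rw [not_le] at hlt
    have hz := family_mem hS' hy hyγ (m + 1)
    have hzlev : 1 / y ^ 2 + b ≤ 1 / S' y (m + 1) ^ 2 := level_orbit_ge hb hlo' hS' (y := y) ⟨hy, hyγ⟩ (by omega)
    have hcz : ∀ j, S' (S' y (m + 1)) j ≤ S (S' y (m + 1)) j := hcomp _ hz.1 hz.2 hzlev
    -- the increment of S′ y at scale m, read on the base family at the deeper pin S′ y (m+1)
    have hflow : 1 / S' y (m + 1) ^ 2 = 1 / S' y m ^ 2 + B' (S' (S' y (m + 1))) := by
      rw [← family_tail_eq hS' huniq' hy hyγ (m + 1)]; exact (hS' y hy hyγ).2.2 m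
    have h1 : B' (S' (S' y (m + 1))) ≤ B' (S (S' y (m + 1))) :=
      hmono' _ _ (hS' _ hz.1 hz.2).1 (hS _ hz.1 hz.2).1 hcz
    -- the scale maps of the base family are increasing in the pin
    have hkm : k (m + 1) ∈ Ioc (0 : ℝ) γ := ⟨(hk (m + 1)).1, (hk (m + 1)).2⟩
    have h2 : B' (S (S' y (m + 1))) ≤ B' (S (k (m + 1))) :=
      hmono' _ _ (hS _ hz.1 hz.2).1 (hS _ hkm.1 hkm.2).1 fun j =>
        (strictMonoOn_scale hb hγ hB hM hlo hS huniq j).monotoneOn hz hkm hlt.le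
    have h3 : 1 / S' y m ^ 2 ≤ 1 / k m ^ 2 :=
      one_div_le_one_div_of_le (pow_pos (hk m).1 2) (pow_le_pow_left₀ (hk m).1.le ih 2)
    have h4 : 1 / S' y (m + 1) ^ 2 ≤ 1 / k (m + 1) ^ 2 := by rw [hflow]; linarith [hbar m]
    exact absurd (le_of_invSq_le hz.1 h4) (not_le.mpr hlt)

/-! ## §3 THE BARRIER PRINCIPLE: one barrier per pin with `B (S y) ≤ B′ k` gives the order of the effective β-functions everywhere -/

/-- **THE BARRIER PRINCIPLE.**  Data as in §1, `B′` ISOTONE.  Suppose that from every pin `y ∈ ]0,γ]` there is a BARRIER `k` (box sequence, `k_0 = y`,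
`1∕k_m² + B′(S k_{m+1}) ≤ 1∕k_{m+1}²` — a super-solution of the `B′`-flow driven along the base family `S`) whose payoff holds: `B (S y) ≤ B′ k`.  Then the
effective β-functions are ordered at EVERY pin, `B (S y) ≤ B′ (S′ y)` — the step of §1 is `B (S y) ≤ B′ k ≤ B′ (S′ y)` by §2 and the isotonicity of `B′`.
(The optimal barrier is the exact accelerated flow `1∕k_{m+1}² = 1∕k_m² + B′(S k_{m+1})`: the time-shift picture of the lineage's numerics with the
retardation included; §4 uses the cruder delayed base trajectory.) [folklore] -/
theorem effective_le_all_of_barrier {b' : ℝ}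
    (hmono' : ∀ u v : ℕ → ℝ, SeqBox γ u → SeqBox γ v → (∀ j, u j ≤ v j) → B' u ≤ B' v)
    (hB : ∀ u u' : ℕ → ℝ, SeqBox γ u → SeqBox γ u' → ∀ D : ℝ, (∀ j, |u j - u' j| ≤ D) → |B u - B u'| ≤ M * D)
    (hM : 0 ≤ M) (hγ : 0 < γ) (hb : 0 < b) (hlo : ∀ u, SeqBox γ u → b ≤ B u) (hexc : ∀ u, SeqBox γ u → B u ≤ B' u)
    (hDmono : ∀ u v : ℕ → ℝ, SeqBox γ u → SeqBox γ v → (∀ j, u j ≤ v j) → B' u - B u ≤ B' v - B v)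
    (hb' : 0 < b') (hB' : ∀ u u' : ℕ → ℝ, SeqBox γ u → SeqBox γ u' → ∀ D : ℝ, (∀ j, |u j - u' j| ≤ D) → |B' u - B' u'| ≤ M' * D)
    (hM' : 0 ≤ M') (hlo' : ∀ u, SeqBox γ u → b' ≤ B' u)
    (hS : ∀ p, 0 < p → p ≤ γ → SeqBox γ (S p) ∧ MemFlow B p (S p))
    (huniq : ∀ p, 0 < p → p ≤ γ → ∀ u u' : ℕ → ℝ, SeqBox γ u → SeqBox γ u' → MemFlow B p u → MemFlow B p u' → u = u')
    (hS' : ∀ p, 0 < p → p ≤ γ → SeqBox γ (S' p) ∧ MemFlow B' p (S' p))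
    (huniq' : ∀ p, 0 < p → p ≤ γ → ∀ u u' : ℕ → ℝ, SeqBox γ u → SeqBox γ u' → MemFlow B' p u → MemFlow B' p u' → u = u')
    (hbar : ∀ y, 0 < y → y ≤ γ → ∃ k : ℕ → ℝ, SeqBox γ k ∧ k 0 = y ∧
      (∀ m, 1 / k m ^ 2 + B' (S (k (m + 1))) ≤ 1 / k (m + 1) ^ 2) ∧ B (S y) ≤ B' k) :
    ∀ y, 0 < y → y ≤ γ → B (S y) ≤ B' (S' y) := by
  have hlo'' : ∀ u, SeqBox γ u → b ≤ B' u := fun u hu => (hlo u hu).trans (hexc u hu)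
  refine effective_le_all_of_step_below hB hM hγ hb hlo hexc hDmono hb' hB' hM' hlo' hS huniq hS' huniq' ?_
  intro y hy hyγ hdeep h h' hh hf hh' hf' _
  obtain ⟨k, hk, hk0, hkbar, hpay⟩ := hbar y hy hyγ
  have e : h = S y := huniq y hy hyγ _ _ hh (hS y hy hyγ).1 hf (hS y hy hyγ).2
  have e' : h' = S' y := huniq' y hy hyγ _ _ hh' (hS' y hy hyγ).1 hf' (hS' y hy hyγ).2
  have hkle : ∀ m, k m ≤ S' y m :=
    barrier_le hmono' hγ hb hB hM hlo hlo'' hS huniq hS' huniq' hy hyγ (fun z hz hzγ hzl => (hdeep z hz hzγ hzl).2) hk hk0 hkbar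
  rw [e, e']
  exact hpay.trans (hmono' k (S' y) hk (hS' y hy hyγ).1 hkle)

/-! ## §4 The floor shift `B′ = B + ε`: the DELAYED BASE TRAJECTORY `1∕k_m² = 1∕h_m² + m·ε` is a barrier; payoffs; the family-free END -/

/-- **THE DELAYED BASE TRAJECTORY IS A BARRIER FOR THE FLOOR SHIFT.**  `B` ISOTONE with zeroth moment `M ≥ 0` and floor `b > 0` on ]0,γ], unique solution
family `S`, pin `y ∈ ]0,γ]`, `ε ≥ 0`; `k > 0` with `1∕k_m² = 1∕(S y m)² + m·ε`.  Then `k` is a box sequence from `y` BELOW `S y` and a super-solution of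
the `(B + ε)`-flow driven along the base family: `1∕k_m² + (B (S k_{m+1}) + ε) ≤ 1∕k_{m+1}²` — because `1∕k_{m+1}² − 1∕k_m² = B (S (S y (m+1))) + ε` and
`B (S k_{m+1}) ≤ B (S (S y (m+1)))` by pin monotonicity. [folklore] -/
theorem delay_barrier
    (hmono : ∀ u v : ℕ → ℝ, SeqBox γ u → SeqBox γ v → (∀ j, u j ≤ v j) → B u ≤ B v)
    (hB : ∀ u u' : ℕ → ℝ, SeqBox γ u → SeqBox γ u' → ∀ D : ℝ, (∀ j, |u j - u' j| ≤ D) → |B u - B u'| ≤ M * D)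
    (hM : 0 ≤ M) (hγ : 0 < γ) (hb : 0 < b) (hlo : ∀ u, SeqBox γ u → b ≤ B u)
    (hS : ∀ p, 0 < p → p ≤ γ → SeqBox γ (S p) ∧ MemFlow B p (S p))
    (huniq : ∀ p, 0 < p → p ≤ γ → ∀ u u' : ℕ → ℝ, SeqBox γ u → SeqBox γ u' → MemFlow B p u → MemFlow B p u' → u = u')
    (hy : 0 < y) (hyγ : y ≤ γ) (hε : 0 ≤ ε) {k : ℕ → ℝ} (hkpos : ∀ m, 0 < k m)
    (hk : ∀ m, 1 / k m ^ 2 = 1 / S y m ^ 2 + (m : ℝ) * ε) :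
    SeqBox γ k ∧ k 0 = y ∧ (∀ m, k m ≤ S y m) ∧
      ∀ m, 1 / k m ^ 2 + (B (S (k (m + 1))) + ε) ≤ 1 / k (m + 1) ^ 2 := by
  have hle : ∀ m, k m ≤ S y m := fun m =>
    le_of_invSq_le (family_mem hS hy hyγ m).1 (by rw [hk m]; nlinarith [Nat.cast_nonneg (α := ℝ) m])
  have hbox : SeqBox γ k := fun m => ⟨hkpos m, (hle m).trans (family_mem hS hy hyγ m).2⟩
  have hk0 : k 0 = y := by
    have e : 1 / k 0 ^ 2 = 1 / y ^ 2 := by rw [hk 0, family_zero hS hy hyγ]; simp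
    exact le_antisymm (by rw [← family_zero hS hy hyγ]; exact hle 0) (le_of_invSq_le (hkpos 0) e.le)
  refine ⟨hbox, hk0, hle, fun m => ?_⟩
  have hz := family_mem hS hy hyγ (m + 1)
  have hkm : k (m + 1) ∈ Ioc (0 : ℝ) γ := ⟨(hbox (m + 1)).1, (hbox (m + 1)).2⟩
  -- the increment of the base trajectory at scale m, read on the base family
  have hflow : 1 / S y (m + 1) ^ 2 = 1 / S y m ^ 2 + B (S (S y (m + 1))) := by
    rw [← family_tail_eq hS huniq hy hyγ (m + 1)]; exact (hS y hy hyγ).2.2 m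
  have h1 : B (S (k (m + 1))) ≤ B (S (S y (m + 1))) :=
    hmono _ _ (hS _ hkm.1 hkm.2).1 (hS _ hz.1 hz.2).1 fun j =>
      (strictMonoOn_scale hb hγ hB hM hlo hS huniq j).monotoneOn hkm hz (hle (m + 1))
  rw [hk m, hk (m + 1), hflow, Nat.cast_succ]
  nlinarith

/-- **THE FLOOR SHIFT UNDER THE DELAY PAYOFF (family form).**  `B` ISOTONE with zeroth moment `M ≥ 0` and floor `b > 0` on ]0,γ], `ε ≥ 0`, unique solution
families `S` of `B` and `S′` of `B + ε`.  If from every pin the DELAY PAYOFF holds — `B (S y) ≤ B k + ε` for the delayed base trajectory `1∕k_m² =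
1∕(S y m)² + m·ε`, `k > 0` — then `B (S y) ≤ B (S′ y) + ε` at every pin: raising the floor raises the effective β-function. [folklore] -/
theorem effective_le_all_of_delay
    (hmono : ∀ u v : ℕ → ℝ, SeqBox γ u → SeqBox γ v → (∀ j, u j ≤ v j) → B u ≤ B v)
    (hB : ∀ u u' : ℕ → ℝ, SeqBox γ u → SeqBox γ u' → ∀ D : ℝ, (∀ j, |u j - u' j| ≤ D) → |B u - B u'| ≤ M * D)
    (hM : 0 ≤ M) (hγ : 0 < γ) (hb : 0 < b) (hlo : ∀ u, SeqBox γ u → b ≤ B u) (hε : 0 ≤ ε)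
    (hS : ∀ p, 0 < p → p ≤ γ → SeqBox γ (S p) ∧ MemFlow B p (S p))
    (huniq : ∀ p, 0 < p → p ≤ γ → ∀ u u' : ℕ → ℝ, SeqBox γ u → SeqBox γ u' → MemFlow B p u → MemFlow B p u' → u = u')
    (hS' : ∀ p, 0 < p → p ≤ γ → SeqBox γ (S' p) ∧ MemFlow (fun u => B u + ε) p (S' p))
    (huniq' : ∀ p, 0 < p → p ≤ γ → ∀ u u' : ℕ → ℝ, SeqBox γ u → SeqBox γ u' →
      MemFlow (fun u => B u + ε) p u → MemFlow (fun u => B u + ε) p u' → u = u')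
    (hdelay : ∀ y, 0 < y → y ≤ γ → ∀ k : ℕ → ℝ, (∀ m, 0 < k m) → (∀ m, 1 / k m ^ 2 = 1 / S y m ^ 2 + (m : ℝ) * ε) →
      B (S y) ≤ B k + ε) :
    ∀ y, 0 < y → y ≤ γ → B (S y) ≤ B (S' y) + ε := by
  have hmono' : ∀ u v : ℕ → ℝ, SeqBox γ u → SeqBox γ v → (∀ j, u j ≤ v j) → (fun u => B u + ε) u ≤ (fun u => B u + ε) v :=
    fun u v hu hv huv => by simpa using hmono u v hu hv huv
  have hB' : ∀ u u' : ℕ → ℝ, SeqBox γ u → SeqBox γ u' → ∀ D : ℝ, (∀ j, |u j - u' j| ≤ D) →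
      |(fun u => B u + ε) u - (fun u => B u + ε) u'| ≤ M * D := fun u u' hu hu' D hD => by simpa using hB u u' hu hu' D hD
  have hexc : ∀ u, SeqBox γ u → B u ≤ (fun u => B u + ε) u := fun u _ => by simpa using hε
  have hDmono : ∀ u v : ℕ → ℝ, SeqBox γ u → SeqBox γ v → (∀ j, u j ≤ v j) →
      (fun u => B u + ε) u - B u ≤ (fun u => B u + ε) v - B v := fun u v _ _ _ => by simp
  have hlo' : ∀ u, SeqBox γ u → b ≤ (fun u => B u + ε) u := fun u hu => by simpa using (hlo u hu).trans (le_add_of_nonneg_right hε)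
  refine effective_le_all_of_barrier hmono' hB hM hγ hb hlo hexc hDmono hb hB' hM hlo' hS huniq hS' huniq' fun y hy hyγ => ?_
  -- the delayed base trajectory from y
  have hq : ∀ m, 0 < 1 / S y m ^ 2 + (m : ℝ) * ε := fun m => by
    have := (family_mem hS hy hyγ m).1; positivity
  set k : ℕ → ℝ := fun m => 1 / Real.sqrt (1 / S y m ^ 2 + (m : ℝ) * ε) with hk_def
  have hkpos : ∀ m, 0 < k m := fun m => one_div_pos.mpr (Real.sqrt_pos.mpr (hq m))
  have hk : ∀ m, 1 / k m ^ 2 = 1 / S y m ^ 2 + (m : ℝ) * ε := fun m => by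
    rw [hk_def]; dsimp only; rw [div_pow, one_pow, Real.sq_sqrt (hq m).le, one_div_one_div]
  obtain ⟨hbox, hk0, -, hkbar⟩ := delay_barrier hmono hB hM hγ hb hlo hS huniq hy hyγ hε hkpos hk
  exact ⟨k, hbox, hk0, hkbar, hdelay y hy hyγ k hkpos hk⟩

/-- **THE DELAY PAYOFF IN THE ZEROTH-MOMENT CLASS** — the estimate behind (E49j)(2)'s threshold: `B` with zeroth moment `M ≥ 0` and floor `b > 0` on ]0,γ],
a box solution `u` from the pin `y` with `M·y ≤ 3√3·b`, `ε ≥ 0`, and `k > 0` with `1∕k_m² = 1∕u_m² + m·ε`.  Then `B u ≤ B k + ε`: `u_m − k_m ≤ (c_m³∕2)·m·ε ≤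
y∕(3√3·b)·ε` (`c_m = (1∕y² + m·b)^{−1∕2}`, (E38a) `weight_sharp_le`), so `|B u − B k| ≤ M·y∕(3√3·b)·ε ≤ ε`. [folklore] -/
theorem delay_payoff_of_zm {u k : ℕ → ℝ}
    (hB : ∀ u u' : ℕ → ℝ, SeqBox γ u → SeqBox γ u' → ∀ D : ℝ, (∀ j, |u j - u' j| ≤ D) → |B u - B u'| ≤ M * D)
    (hb : 0 < b) (hlo : ∀ u, SeqBox γ u → b ≤ B u) (hy : 0 < y) (hsmall : M * y ≤ 3 * Real.sqrt 3 * b) (hε : 0 ≤ ε)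
    (hu : SeqBox γ u) (hf : MemFlow B y u) (hkpos : ∀ m, 0 < k m) (hk : ∀ m, 1 / k m ^ 2 = 1 / u m ^ 2 + (m : ℝ) * ε) :
    B u ≤ B k + ε := by
  have h33 : 0 < 3 * Real.sqrt 3 * b := mul_pos three_sqrt_three_pos hb
  have hle : ∀ m, k m ≤ u m := fun m =>
    le_of_invSq_le (hu m).1 (by rw [hk m]; nlinarith [Nat.cast_nonneg (α := ℝ) m])
  have hkbox : SeqBox γ k := fun m => ⟨hkpos m, (hle m).trans (hu m).2⟩
  -- the gap u_m − k_m ≤ (c_m³/2)·m·ε ≤ y/(3√3 b)·ε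
  have hgap : ∀ m, |u m - k m| ≤ y / (3 * Real.sqrt 3 * b) * ε := by
    intro m
    set P : ℝ := 1 / y ^ 2 + (m : ℝ) * b with hP
    have hP0 : 0 < P := by positivity
    have huP : P ≤ 1 / u m ^ 2 := by rw [invSq_eq_of_memFlow hf m]; exact add_le_add le_rfl (mul_lower_le_drive hlo hu m)
    have hkP : P ≤ 1 / k m ^ 2 := huP.trans (by rw [hk m]; nlinarith [Nat.cast_nonneg (α := ℝ) m])
    set C : ℝ := 1 / Real.sqrt P with hC
    have hC : u m ≤ C := le_inv_sqrt_of_le_inv_sq (hu m).1 hP0 huP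
    have hC' : k m ≤ C := le_inv_sqrt_of_le_inv_sq (hkpos m) hP0 hkP
    have hw := abs_sub_le_half_cube_mul (hu m).1 (hkpos m) hC hC'
    have hW : (m : ℝ) * (C ^ 3 / 2) ≤ y / (3 * Real.sqrt 3 * b) := weight_sharp_le hy hb m
    have habs : |1 / u m ^ 2 - 1 / k m ^ 2| = (m : ℝ) * ε := by
      rw [hk m, show 1 / u m ^ 2 - (1 / u m ^ 2 + (m : ℝ) * ε) = -((m : ℝ) * ε) by ring, abs_neg,
        abs_of_nonneg (mul_nonneg (Nat.cast_nonneg m) hε)]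
    calc |u m - k m| ≤ C ^ 3 / 2 * |1 / u m ^ 2 - 1 / k m ^ 2| := hw
      _ = (m : ℝ) * (C ^ 3 / 2) * ε := by rw [habs]; ring
      _ ≤ y / (3 * Real.sqrt 3 * b) * ε := mul_le_mul_of_nonneg_right hW hε
  have hdrop : |B u - B k| ≤ M * (y / (3 * Real.sqrt 3 * b) * ε) := hB u k hu hkbox _ hgap
  have hq : M * (y / (3 * Real.sqrt 3 * b) * ε) ≤ ε := by
    rw [show M * (y / (3 * Real.sqrt 3 * b) * ε) = (M * y / (3 * Real.sqrt 3 * b)) * ε by ring]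
    have : M * y / (3 * Real.sqrt 3 * b) ≤ 1 := by rw [div_le_one h33]; exact hsmall
    nlinarith
  linarith [(abs_le.mp (hdrop.trans hq)).2]

/-- **RAISING THE FLOOR LOWERS THE TRAJECTORY, UNDER THE DELAY PAYOFF (family-free END).**  `B` ISOTONE on ]0,γ] with zeroth moment `M ≥ 0` (ANY size) and
floor `b > 0`; `ε ≥ 0`; suppose the DELAY PAYOFF from every pin: for every box solution `u` of `B` from `y ∈ ]0,γ]` and `k > 0` with `1∕k_m² = 1∕u_m² +
m·ε`, `B u ≤ B k + ε` (§4 `delay_payoff_of_zm` under `M·γ ≤ 3√3·b`; (E58b)'s level-weight estimate under `Q ≤ 2` for the dominated class).  Then ANY box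
solutions `h` of `B` and `h′` of `B + ε` from one pin `p ∈ ]0,γ]` satisfy `h′ ≤ h` at EVERY scale. [folklore] -/
theorem le_of_floor_shift_of_delay {p : ℝ}
    (hmono : ∀ u v : ℕ → ℝ, SeqBox γ u → SeqBox γ v → (∀ j, u j ≤ v j) → B u ≤ B v)
    (hB : ∀ u u' : ℕ → ℝ, SeqBox γ u → SeqBox γ u' → ∀ D : ℝ, (∀ j, |u j - u' j| ≤ D) → |B u - B u'| ≤ M * D)
    (hM : 0 ≤ M) (hb : 0 < b) (hlo : ∀ u, SeqBox γ u → b ≤ B u) (hε : 0 ≤ ε)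
    (hdelay : ∀ y, 0 < y → y ≤ γ → ∀ u k : ℕ → ℝ, SeqBox γ u → MemFlow B y u → (∀ m, 0 < k m) →
      (∀ m, 1 / k m ^ 2 = 1 / u m ^ 2 + (m : ℝ) * ε) → B u ≤ B k + ε)
    (hp : 0 < p) (hpγ : p ≤ γ) (hh : SeqBox γ h) (hf : MemFlow B p h) (hh' : SeqBox γ h')
    (hf' : MemFlow (fun u => B u + ε) p h') (j : ℕ) : h' j ≤ h j := by
  have hγ : 0 < γ := hp.trans_le hpγ
  have hmono' : ∀ u v : ℕ → ℝ, SeqBox γ u → SeqBox γ v → (∀ j, u j ≤ v j) → (fun u => B u + ε) u ≤ (fun u => B u + ε) v :=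
    fun u v hu hv huv => by simpa using hmono u v hu hv huv
  have hB' : ∀ u u' : ℕ → ℝ, SeqBox γ u → SeqBox γ u' → ∀ D : ℝ, (∀ j, |u j - u' j| ≤ D) →
      |(fun u => B u + ε) u - (fun u => B u + ε) u'| ≤ M * D := fun u u' hu hu' D hD => by simpa using hB u u' hu hu' D hD
  have hlo' : ∀ u, SeqBox γ u → b ≤ (fun u => B u + ε) u := fun u hu => by simpa using (hlo u hu).trans (le_add_of_nonneg_right hε)
  -- the two solution families
  have hex : ∀ q : ℝ, 0 < q → q ≤ γ → ∃ k : ℕ → ℝ, SeqBox γ k ∧ MemFlow B q k := fun q hq hqγ => exists_memFlow_zm hB hM hq hqγ hb hlo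
  have hex' : ∀ q : ℝ, 0 < q → q ≤ γ → ∃ k : ℕ → ℝ, SeqBox γ k ∧ MemFlow (fun u => B u + ε) q k :=
    fun q hq hqγ => exists_memFlow_zm hB' hM hq hqγ hb hlo'
  choose! S hSb hSf using hex
  choose! S' hS'b hS'f using hex'
  have hS : ∀ q, 0 < q → q ≤ γ → SeqBox γ (S q) ∧ MemFlow B q (S q) := fun q hq hqγ => ⟨hSb q hq hqγ, hSf q hq hqγ⟩
  have hS' : ∀ q, 0 < q → q ≤ γ → SeqBox γ (S' q) ∧ MemFlow (fun u => B u + ε) q (S' q) :=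
    fun q hq hqγ => ⟨hS'b q hq hqγ, hS'f q hq hqγ⟩
  have huniq : ∀ q, 0 < q → q ≤ γ → ∀ u u' : ℕ → ℝ, SeqBox γ u → SeqBox γ u' → MemFlow B q u → MemFlow B q u' → u = u' :=
    fun q hq _ u u' hu hu' hfu hfu' => memFlow_unique_of_monotone_zm hmono hB hM hq hb hlo hu hu' hfu hfu'
  have huniq' : ∀ q, 0 < q → q ≤ γ → ∀ u u' : ℕ → ℝ, SeqBox γ u → SeqBox γ u' →
      MemFlow (fun u => B u + ε) q u → MemFlow (fun u => B u + ε) q u' → u = u' :=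
    fun q hq _ u u' hu hu' hfu hfu' => memFlow_unique_of_monotone_zm hmono' hB' hM hq hb hlo' hu hu' hfu hfu'
  have hall := effective_le_all_of_delay hmono hB hM hγ hb hlo hε hS huniq hS' huniq'
    (fun y hy hyγ k hkpos hk => hdelay y hy hyγ (S y) k (hS y hy hyγ).1 (hS y hy hyγ).2 hkpos hk)
  have e : h = S p := huniq p hp hpγ _ _ hh (hS p hp hpγ).1 hf (hS p hp hpγ).2
  have e' : h' = S' p := huniq' p hp hpγ _ _ hh' (hS' p hp hpγ).1 hf' (hS' p hp hpγ).2
  rw [e, e']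
  exact family_le_of_orbit hb hγ hB' hM hlo' hS huniq hS' huniq' ⟨hp, hpγ⟩
    (fun i _ => hall _ (family_mem hS hp hpγ i).1 (family_mem hS hp hpγ i).2) j

end Summit.QuantumFields.BalabanUV.Beta.EriceRemainderEnclosureHistoryAutonomyComparisonBarrier

end
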